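import Literature.Geometry.Riemannian.SharpLogSobolevAVRNeumann
import Literature.Geometry.Riemannian.NeumannSolutionC2
import Literature.Geometry.Riemannian.SmoothApproximationOperators
import HarnessLib

/-!
# The sharp log-Sobolev inequality on `AVR` four-manifolds: discharge of
# `sharpLogSobolevAVR_four`

Topic `Geometry/Riemannian`. Theorem file (no definitions, no named facts; everything proved).
`SharpLogSobolevAVRNeumann.lean` reduces `Literature.Geometry.Riemannian.sharpLogSobolevAVR_four`
(Balogh–Kristály–Tripaldi, Thm. 1.1 with `p = 2`, `N = n = 4`, smooth case = Brendle, Thm. 1.1) to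
the solvability, on a smooth relatively compact regular domain `D = {σ < 0} ⊇ K`, of the Neumann
*super*-problem `div_h(f ∇u) ≤ F` in `D`, `⟨∇u, ν⟩ ≥ 1` on `∂D` under the compatibility
`c · A ≤ ∫_D F` (`sharpLogSobolevAVR_four_of_neumann`). Here this PDE input is supplied
(`exists_neumann_supersolution`): the domain comes from `ConnectedRegularDomain.lean`; an exact
`C²` solution of `div(f ∇u₀) = F₁`, `∂_ν u₀ = 0` with a mean-zero `F₁ = F - c Δ_h W - η₁` from
`NeumannSolutionC2.lean` (Taylor, *PDE I*, Ch. 5 §7); a smooth approximation `u_s` of `u₀` in the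
operator seminorms (`SmoothApproximationOperators.lean`); and the boundary corrector
`W = Λ ψ σ` (with `ψ = 1` on `∂D`, `ψ = 0` near `K`), so that `u = u_s + W` satisfies both
inequalities with room `η₁` resp. `√|∇σ|²`. Then
`sharpLogSobolevAVR_four_holds : sharpLogSobolevAVR_four`.

## References

* Z. M. Balogh, A. Kristály, F. Tripaldi, *Sharp log-Sobolev inequalities in `CD(0,N)` spaces with
  applications*, J. Funct. Anal. 286 (2024), arXiv:2210.15774, Theorem 1.1. [BaloghKristalyTripaldi2024]
* S. Brendle, *Sobolev inequalities in manifolds with nonnegative curvature*, Comm. Pure Appl.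
  Math. 76 (2022), Theorem 1.1 and §2. [Brendle2022]
* M. E. Taylor, *Partial Differential Equations I*, 2nd ed. (2011), Ch. 5 §7. [TaylorPDEI2011]
-/

noncomputable section

open MeasureTheory Measure Set Filter Metric Module TopologicalSpace Function
open scoped ENNReal NNReal Manifold ContDiff Topology

namespace Literature.Geometry.Riemannian

open Lorentzian
open Bundle PseudoRiemannianMetric

section Supersolution

variable {m : ℕ} {P : Type*} [TopologicalSpace P] [ChartedSpace (EuclideanSpace ℝ (Fin m)) P]
  [IsManifold (𝓡 m) ∞ P] [T2Space P] [SecondCountableTopology P] [LocallyCompactSpace P]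
  [SigmaCompactSpace P] [MeasurableSpace P] [BorelSpace P]
  (g : PseudoRiemannianMetric (𝓡 m) ∞ (EuclideanSpace ℝ (Fin m)) (TangentSpace (𝓡 m) : P → Type _))
  [g.HasLeviCivita]

omit [T2Space P] [SecondCountableTopology P] [LocallyCompactSpace P] [SigmaCompactSpace P]
  [MeasurableSpace P] [BorelSpace P] [g.HasLeviCivita] in
/-- `h(∇f, ∇u) = h⁻¹(df, du)`. [folklore] -/
theorem val_grad_grad (f u : P → ℝ) (x : P) :
    g.val x (grad g f x) (grad g u x) =
      g.innerDual x (mvfderiv (𝓡 m) f x).toLinearMap (mvfderiv (𝓡 m) u x).toLinearMap := by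
  rw [val_grad]; rfl

/-- A continuous function, positive on a compact set, has a positive lower bound there.
[folklore] -/
theorem exists_pos_forall_le_of_isCompact {X : Type*} [TopologicalSpace X] {Z : Set X}
    (hZ : IsCompact Z) {φ : X → ℝ} (hφ : ContinuousOn φ Z) (hpos : ∀ x ∈ Z, 0 < φ x) :
    ∃ s : ℝ, 0 < s ∧ ∀ x ∈ Z, s ≤ φ x := by
  rcases Z.eq_empty_or_nonempty with hZe | hZne
  · exact ⟨1, one_pos, fun x hx ↦ by simp [hZe] at hx⟩
  · obtain ⟨x₀, hx₀, hmin⟩ := hZ.exists_isMinOn hZne hφ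
    exact ⟨φ x₀, hpos x₀ hx₀, fun x hx ↦ hmin hx⟩

set_option maxHeartbeats 6400000 in
/-- **The Neumann super-solution on a regular domain** (the PDE input of Brendle's ABP proof,
Brendle 2022 §2, via Taylor's Neumann theory): for a compact `K` in a connected Riemannian
manifold modelled on `ℝ⁴` with a point outside `K`, there are a smooth relatively compact regular
connected domain `D = {σ < 0} ⊇ K` and `A ≥ 0` such that for all smooth `f > 0` with `f = c` off
`K` and smooth `F` with `c A ≤ ∫_D F` some smooth `u` satisfies `f Δu + ⟨∇f, ∇u⟩ ≤ F` on `D` and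
`√|∇σ|² ≤ ⟨∇u, ∇σ⟩` on `∂D`. [cite: Brendle2022, §2] [cite: TaylorPDEI2011, Ch. 5 §7, Prop. 7.4–7.7] -/
theorem exists_neumann_supersolution [ConnectedSpace P] (hg : g.IsRiemannian)
    (hm4 : Module.finrank ℝ (EuclideanSpace ℝ (Fin m)) = 4) {K : Set P} (hK : IsCompact K)
    (hKne : Kᶜ.Nonempty) :
    ∃ (σ : P → ℝ) (A : ℝ), ContMDiff (𝓡 m) 𝓘(ℝ, ℝ) ∞ σ ∧
      K ⊆ {x | σ x < 0} ∧ IsCompact {x | σ x ≤ 0} ∧ (∃ x, σ x < 0) ∧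
      (∀ x, σ x = 0 → 0 < g.gradSq σ x) ∧ 0 ≤ A ∧
      ∀ (f F : P → ℝ) (c : ℝ), ContMDiff (𝓡 m) 𝓘(ℝ, ℝ) ∞ f → ContMDiff (𝓡 m) 𝓘(ℝ, ℝ) ∞ F →
        (∀ x, 0 < f x) → (∀ x, x ∉ K → f x = c) →
        c * A ≤ ∫ x in {x | σ x < 0}, F x ∂(riemannianMeasure (g.toContMDiffRiemannianMetric hg)) →
        ∃ u : P → ℝ, ContMDiff (𝓡 m) 𝓘(ℝ, ℝ) ∞ u ∧
          (∀ x, σ x < 0 → f x * g.dalembertian u x + g.val x (grad g f x) (grad g u x) ≤ F x) ∧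
          (∀ x, σ x = 0 → Real.sqrt (g.gradSq σ x) ≤ g.val x (grad g u x) (grad g σ x)) := by
  classical
  set h := g.toContMDiffRiemannianMetric hg with hh_def
  set μ : Measure P := riemannianMeasure h with hμ
  haveI : (ofRiemannian h).HasLeviCivita := ‹g.HasLeviCivita›
  haveI : IsFiniteMeasureOnCompacts μ :=
    ⟨fun K hK ↦ riemannianVolume_lt_top_of_isCompact_holds h le_rfl hK⟩
  haveI : μ.IsOpenPosMeasure := isOpenPosMeasure_riemannianMeasure h
  /- Step 1: the domain -/
  obtain ⟨σ, hσ, hKσ, hcpt, hconn, hregd⟩ := exists_connected_regular_sublevel_domain (m := m) hK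
  have hreg : ∀ x, σ x = 0 → 0 < g.gradSq σ x := fun x hx ↦
    gradSq_pos_of_mvfderiv_ne_zero g hg (hregd x hx)
  set D : Set P := {x | σ x < 0} with hD
  set Z : Set P := {x | σ x = 0} with hZ
  set K' : Set P := {x | σ x ≤ 0} with hK'
  have hDo : IsOpen D := isOpen_lt hσ.continuous continuous_const
  have hDm : MeasurableSet D := hDo.measurableSet
  have hZcl : IsClosed Z := isClosed_eq hσ.continuous continuous_const
  have hZK' : Z ⊆ K' := fun x (hx : σ x = 0) ↦ (le_of_eq hx : σ x ≤ 0)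
  have hDK' : D ⊆ K' := fun x (hx : σ x < 0) ↦ (hx.le : σ x ≤ 0)
  have hZc : IsCompact Z := hcpt.of_isClosed_subset hZcl hZK'
  have hDne : D.Nonempty := hconn.nonempty
  have hμD : μ D < ⊤ := (measure_mono hDK').trans_lt hcpt.measure_lt_top
  have hμD0 : 0 < μ.real D := by
    rw [Measure.real, ENNReal.toReal_pos_iff]
    exact ⟨hDo.measure_pos μ hDne, hμD⟩
  have hintD : ∀ {φ : P → ℝ}, Continuous φ → IntegrableOn φ D μ := fun hφ ↦
    (hφ.continuousOn.integrableOn_compact hcpt).mono_set hDK'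
  /- Step 2: a lower bound for `|∇σ|²` on `∂D` -/
  have hσ1 : ContMDiff (𝓡 m) 𝓘(ℝ, ℝ) 1 σ := hσ.of_le (by norm_cast)
  have hgradSq_c : Continuous (g.gradSq σ) := continuous_innerDual_mvfderiv g hσ1 hσ1
  obtain ⟨s₀, hs₀, hs₀le⟩ := exists_pos_forall_le_of_isCompact hZc hgradSq_c.continuousOn hreg
  /- Step 3: the cutoff `ψ` (`= 0` near `K`, `= 1` on `∂D`) and the corrector `W = Λ ψ σ` -/
  obtain ⟨L, hLc, hKL, hLD⟩ := exists_compact_between hK hDo hKσ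
  obtain ⟨ψ, hψL, hψZ, -⟩ := exists_contMDiffMap_zero_one_of_isClosed (I := 𝓡 m) (n := (⊤ : ℕ∞))
    hLc.isClosed hZcl (Set.disjoint_left.2 fun x hxL hxZ ↦ (hLD hxL).ne hxZ)
  set Λ : ℝ := 2 / Real.sqrt s₀ with hΛ
  have hΛpos : 0 < Λ := by positivity
  set W : P → ℝ := fun x ↦ Λ * (ψ x * σ x) with hW
  have hψs : ContMDiff (𝓡 m) 𝓘(ℝ, ℝ) ∞ ψ := ψ.contMDiff
  have hWs : ContMDiff (𝓡 m) 𝓘(ℝ, ℝ) ∞ W := contMDiff_const.mul (hψs.mul hσ)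
  have hΔWs : ContMDiff (𝓡 m) 𝓘(ℝ, ℝ) ∞ (g.dalembertian W) := contMDiff_dalembertian g hWs
  -- `W` vanishes near `K`
  have hW0 : ∀ x ∈ K, W =ᶠ[𝓝 x] fun _ ↦ 0 := fun x hx ↦ by
    filter_upwards [isOpen_interior.mem_nhds (hKL hx)] with y hy
    simp only [hW, hψL (interior_subset hy), Pi.zero_apply, zero_mul, mul_zero]
  -- the derivative of `W` on `∂D`
  have hdW : ∀ x, σ x = 0 → mvfderiv (𝓡 m) W x = Λ • mvfderiv (𝓡 m) σ x := by
    intro x hx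
    have hψmd : MDifferentiableAt (𝓡 m) 𝓘(ℝ, ℝ) ψ x := (hψs x).mdifferentiableAt (by simp)
    have hσmd : MDifferentiableAt (𝓡 m) 𝓘(ℝ, ℝ) σ x := (hσ x).mdifferentiableAt (by simp)
    have hprod : MDifferentiableAt (𝓡 m) 𝓘(ℝ, ℝ) (fun y ↦ ψ y * σ y) x := hψmd.mul hσmd
    have h1 : mvfderiv (𝓡 m) (fun y ↦ ψ y * σ y) x = mvfderiv (𝓡 m) σ x := by
      rw [mvfderiv_fun_mul hψmd hσmd, hx, zero_smul, add_zero, hψZ hx, Pi.one_apply, one_smul]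
    have h2 : mvfderiv (𝓡 m) W x = Λ • mvfderiv (𝓡 m) (fun y ↦ ψ y * σ y) x :=
      KarpukhinStern.mvfderiv_const_mul hprod Λ
    rw [h2, h1]
  have hWZ : ∀ x, σ x = 0 → g.innerDual x (mvfderiv (𝓡 m) W x).toLinearMap
      (mvfderiv (𝓡 m) σ x).toLinearMap = Λ * g.gradSq σ x := by
    intro x hx
    rw [hdW x hx, ContinuousLinearMap.toLinearMap_smul]
    rfl
  /- Step 4: the constant `A` -/
  set I : ℝ := ∫ x in D, g.dalembertian W x ∂μ with hI
  set A : ℝ := max I 0 + 1 with hA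
  have hA0 : 0 ≤ A := by positivity
  have hAI : I + 1 ≤ A := by simp only [hA]; linarith [le_max_left I 0]
  refine ⟨σ, A, hσ, hKσ, hcpt, hDne, hreg, hA0, fun f F c hf hF hfpos hfc hint ↦ ?_⟩
  /- Step 5: the data of the exact Neumann problem -/
  obtain ⟨p₀, hp₀⟩ := hKne
  have hc : 0 < c := by rw [← hfc p₀ hp₀]; exact hfpos p₀
  -- `f ΔW + ⟨∇f, ∇W⟩ = c ΔW` everywhere
  have hG : ∀ x, f x * g.dalembertian W x + g.val x (grad g f x) (grad g W x) =
      c * g.dalembertian W x := by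
    intro x
    by_cases hx : x ∈ K
    · have h0 : g.dalembertian W x = 0 := dalembertian_eq_zero_of_eventuallyEq_zero g (hW0 x hx)
      have hd0 : mvfderiv (𝓡 m) W x = 0 := mvfderiv_eq_zero_of_eventuallyEq_zero (hW0 x hx)
      rw [h0, val_grad_grad, hd0, ContinuousLinearMap.toLinearMap_zero]
      simp [PseudoRiemannianMetric.innerDual]
    · have hfev : f =ᶠ[𝓝 x] fun _ ↦ c := by
        filter_upwards [hK.isClosed.isOpen_compl.mem_nhds hx] with y hy using hfc y hy
      have hdf : mvfderiv (𝓡 m) f x = 0 := by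
        have : mvfderiv (𝓡 m) (fun y ↦ f y - c) x = 0 :=
          mvfderiv_eq_zero_of_eventuallyEq_zero (by
            filter_upwards [hfev] with y hy; simp [hy])
        rwa [mvfderiv_fun_sub ((hf x).mdifferentiableAt (by simp)) mdifferentiableAt_const,
          mvfderiv_const, sub_zero] at this
      rw [hfc x hx, val_grad_grad, hdf, ContinuousLinearMap.toLinearMap_zero]
      simp [PseudoRiemannianMetric.innerDual]
  -- the slack
  set S : ℝ := (∫ x in D, F x ∂μ) - c * I with hS
  have hcS : c ≤ S := by
    have : c * (I + 1) ≤ c * A := mul_le_mul_of_nonneg_left hAI hc.le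
    rw [hS]; nlinarith
  have hSpos : 0 < S := hc.trans_le hcS
  set η₁ : ℝ := S / μ.real D with hη₁_def
  have hη₁ : 0 < η₁ := by positivity
  set F₁ : P → ℝ := fun x ↦ F x - c * g.dalembertian W x - η₁ with hF₁
  have hF₁s : ContMDiff (𝓡 m) 𝓘(ℝ, ℝ) ∞ F₁ :=
    (hF.sub (contMDiff_const.mul hΔWs)).sub contMDiff_const
  have hmean : ∫ x in D, F₁ x ∂μ = 0 := by
    have i1 : IntegrableOn F D μ := hintD hF.continuous
    have i2 : IntegrableOn (fun x ↦ c * g.dalembertian W x) D μ :=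
      (hintD hΔWs.continuous).const_mul c
    have i3 : IntegrableOn (fun _ ↦ η₁) D μ := hintD continuous_const
    have i12 : IntegrableOn (fun x ↦ F x - c * g.dalembertian W x) D μ := i1.sub i2
    simp only [hF₁]
    rw [integral_sub i12 i3, integral_sub i1 i2, integral_const_mul, setIntegral_const,
      smul_eq_mul]
    have : μ.real D * η₁ = S := by rw [hη₁_def]; field_simp
    rw [this, hS]; ring
  /- Step 6: the exact `C²` solution and its smoothing -/
  obtain ⟨u₀, hu₀, hpde₀, hbc₀⟩ := exists_contMDiff_two_neumann_solution g hg hm4 hσ hcpt hconn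
    hregd hf hfpos hF₁s hmean
  -- an upper bound for `f` on `D̄`
  obtain ⟨Cf, hCf⟩ : ∃ C : ℝ, ∀ x ∈ K', f x ≤ C := by
    obtain ⟨C, hC⟩ := hcpt.exists_bound_of_continuousOn hf.continuous.continuousOn
    exact ⟨C, fun x hx ↦ (le_abs_self _).trans (by simpa [Real.norm_eq_abs] using hC x hx)⟩
  set Cf' : ℝ := max Cf 0 with hCf'
  have hfle : ∀ x ∈ K', f x ≤ Cf' := fun x hx ↦ (hCf x hx).trans (le_max_left _ _)
  set ε₀ : ℝ := min (η₁ / (Cf' + 1)) (Real.sqrt s₀) with hε₀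
  have hε₀ : 0 < ε₀ := by positivity
  have hε₀η : (Cf' + 1) * ε₀ ≤ η₁ := by
    have : ε₀ ≤ η₁ / (Cf' + 1) := min_le_left _ _
    rwa [le_div_iff₀ (by positivity), mul_comm] at this
  have hε₀s : ε₀ ≤ Real.sqrt s₀ := min_le_right _ _
  -- the probes `f, σ`
  set a : Fin 2 → P → ℝ := ![f, σ] with ha_def
  have ha : ∀ l, ContMDiff (𝓡 m) 𝓘(ℝ, ℝ) ∞ (a l) := fun l ↦ by
    fin_cases l
    · exact hf
    · exact hσ
  obtain ⟨us, hus, hest⟩ := exists_contMDiff_approx_operators h hu₀ hcpt ha hε₀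
  have hestΔ : ∀ x ∈ K', |g.dalembertian us x - g.dalembertian u₀ x| ≤ ε₀ := fun x hx ↦
    (hest x hx).1
  have hestf : ∀ x ∈ K', |g.innerDual x (mvfderiv (𝓡 m) us x).toLinearMap
      (mvfderiv (𝓡 m) f x).toLinearMap - g.innerDual x (mvfderiv (𝓡 m) u₀ x).toLinearMap
      (mvfderiv (𝓡 m) f x).toLinearMap| ≤ ε₀ := fun x hx ↦ (hest x hx).2 0
  have hestσ : ∀ x ∈ K', |g.innerDual x (mvfderiv (𝓡 m) us x).toLinearMap
      (mvfderiv (𝓡 m) σ x).toLinearMap - g.innerDual x (mvfderiv (𝓡 m) u₀ x).toLinearMap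
      (mvfderiv (𝓡 m) σ x).toLinearMap| ≤ ε₀ := fun x hx ↦ (hest x hx).2 1
  /- Step 7: the super-solution `u = u_s + W` -/
  set u : P → ℝ := fun x ↦ us x + 1 * W x with hu
  have huS : ContMDiff (𝓡 m) 𝓘(ℝ, ℝ) ∞ u := hus.add (contMDiff_const.mul hWs)
  have hdu : ∀ x, mvfderiv (𝓡 m) u x = mvfderiv (𝓡 m) us x + mvfderiv (𝓡 m) W x := fun x ↦ by
    have e : u = us + W := funext fun y ↦ by simp [hu]
    rw [e, mvfderiv_add ((hus x).mdifferentiableAt (by simp)) ((hWs x).mdifferentiableAt (by simp))]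
  have hΔu : ∀ x, g.dalembertian u x = g.dalembertian us x + g.dalembertian W x := fun x ↦ by
    rw [hu, dalembertian_add_const_mul_of_contMDiffAt g ((hus.of_le (by norm_cast)) x)
      ((hWs.of_le (by norm_cast)) x) 1, one_mul]
  refine ⟨u, huS, fun x hx ↦ ?_, fun x hx ↦ ?_⟩
  · -- the differential inequality on `D`
    have hxK' : x ∈ K' := hDK' hx
    have h0 := hpde₀ x hx
    rw [val_grad_grad] at h0
    have hGx := hG x
    rw [val_grad_grad] at hGx
    rw [hΔu, val_grad_grad, hdu, ContinuousLinearMap.toLinearMap_add]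
    rw [PseudoRiemannianMetric.innerDual_comm] at h0 hGx ⊢
    have e : g.innerDual x ((mvfderiv (𝓡 m) us x).toLinearMap + (mvfderiv (𝓡 m) W x).toLinearMap)
        (mvfderiv (𝓡 m) f x).toLinearMap =
        g.innerDual x (mvfderiv (𝓡 m) us x).toLinearMap (mvfderiv (𝓡 m) f x).toLinearMap +
        g.innerDual x (mvfderiv (𝓡 m) W x).toLinearMap (mvfderiv (𝓡 m) f x).toLinearMap :=
      LinearMap.add_apply _ _ _
    rw [e]
    have h1 := abs_sub_le_iff.1 (hestΔ x hxK')
    have h2 := abs_sub_le_iff.1 (hestf x hxK')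
    have hfx := hfpos x
    have hfxle := hfle x hxK'
    have hF₁x : F₁ x = F x - c * g.dalembertian W x - η₁ := rfl
    rw [hF₁x] at h0
    have key : f x * (g.dalembertian us x - g.dalembertian u₀ x) ≤ f x * ε₀ :=
      mul_le_mul_of_nonneg_left h1.1 hfx.le
    nlinarith [h2.1, hε₀η, mul_le_mul_of_nonneg_right hfxle hε₀.le]
  · -- the boundary inequality on `∂D`
    have hxK' : x ∈ K' := hZK' hx
    rw [val_grad_grad, hdu, ContinuousLinearMap.toLinearMap_add]
    have e : g.innerDual x ((mvfderiv (𝓡 m) us x).toLinearMap + (mvfderiv (𝓡 m) W x).toLinearMap)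
        (mvfderiv (𝓡 m) σ x).toLinearMap =
        g.innerDual x (mvfderiv (𝓡 m) us x).toLinearMap (mvfderiv (𝓡 m) σ x).toLinearMap +
        g.innerDual x (mvfderiv (𝓡 m) W x).toLinearMap (mvfderiv (𝓡 m) σ x).toLinearMap :=
      LinearMap.add_apply _ _ _
    rw [e, hWZ x hx]
    have h0 := hbc₀ x hx
    have h2 := abs_sub_le_iff.1 (hestσ x hxK')
    rw [h0] at h2
    -- `q = √|∇σ|² ≥ √s₀ ≥ ε₀` and `Λ q² = 2 q (q / √s₀) ≥ 2 q`
    set q : ℝ := Real.sqrt (g.gradSq σ x) with hq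
    have hq0 : 0 < g.gradSq σ x := hreg x hx
    have hqsq : g.gradSq σ x = q ^ 2 := by rw [hq, Real.sq_sqrt hq0.le]
    have hqs : Real.sqrt s₀ ≤ q := Real.sqrt_le_sqrt (hs₀le x hx)
    have hs₀' : 0 < Real.sqrt s₀ := Real.sqrt_pos.2 hs₀
    have hΛq : 2 * q ≤ Λ * g.gradSq σ x := by
      rw [hqsq, hΛ]
      rw [div_mul_eq_mul_div, le_div_iff₀ hs₀', pow_two]
      nlinarith [mul_le_mul_of_nonneg_left hqs (by positivity : (0 : ℝ) ≤ 2 * q)]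
    nlinarith [h2.1, h2.2, hε₀s]

end Supersolution

/-- **Discharge of `sharpLogSobolevAVR_four`** (Balogh–Kristály–Tripaldi 2024, Thm. 1.1 with
`p = 2`, `N = n = 4`; smooth case: Brendle 2022, Thm. 1.1): the ABP reduction
`sharpLogSobolevAVR_four_of_neumann` fed with `exists_neumann_supersolution`.
[cite: BaloghKristalyTripaldi2024, Thm. 1.1] [cite: Brendle2022, Thm. 1.1] -/
theorem sharpLogSobolevAVR_four_holds : sharpLogSobolevAVR_four := by
  refine sharpLogSobolevAVR_four_of_neumann ?_
  intro P _ _ _ _ _ _ _ _ _ h _ hh θ hproper hRic hθ havr K hK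
  haveI : LocallyCompactSpace P := ChartedSpace.locallyCompactSpace (EuclideanSpace ℝ (Fin 4)) P
  haveI : SigmaCompactSpace P := sigmaCompactSpace_of_locallyCompact_secondCountable
  -- the manifold is not compact (`AVR > 0`), so there is a point outside `K`
  have hKne : Kᶜ.Nonempty := by
    by_contra hKe
    rw [not_nonempty_iff_eq_empty, compl_empty_iff] at hKe
    haveI : CompactSpace P := ⟨by rw [← hKe]; exact hK⟩
    set μ := riemannianMeasure (h.toContMDiffRiemannianMetric hh) with hμ
    have hfin : μ univ < ⊤ :=
      riemannianVolume_lt_top_of_isCompact_holds (h.toContMDiffRiemannianMetric hh) le_rfl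
        isCompact_univ
    obtain ⟨x⟩ := (inferInstance : Nonempty P)
    -- the volume ratio tends to `0`
    have hlim : Tendsto (fun r : ℝ ↦ (μ {y : P | h.edist hh x y ≤ ENNReal.ofReal r}).toReal /
        (Real.pi ^ 2 / 2 * r ^ 4)) atTop (𝓝 0) := by
      have hb : ∀ r : ℝ, |(μ {y : P | h.edist hh x y ≤ ENNReal.ofReal r}).toReal /
          (Real.pi ^ 2 / 2 * r ^ 4)| ≤ (μ univ).toReal * |(Real.pi ^ 2 / 2 * r ^ 4)⁻¹| := by
        intro r
        rw [div_eq_mul_inv, abs_mul, abs_of_nonneg ENNReal.toReal_nonneg]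
        exact mul_le_mul_of_nonneg_right
          (ENNReal.toReal_mono hfin.ne (measure_mono (subset_univ _))) (abs_nonneg _)
      have h0 : Tendsto (fun r : ℝ ↦ (μ univ).toReal * |(Real.pi ^ 2 / 2 * r ^ 4)⁻¹|) atTop
          (𝓝 0) := by
        rw [← mul_zero (μ univ).toReal]
        refine Tendsto.const_mul _ ?_
        rw [← abs_zero]
        refine (Tendsto.inv_tendsto_atTop ?_).abs
        exact Tendsto.const_mul_atTop (by positivity) (tendsto_pow_atTop four_ne_zero)
      exact squeeze_zero_norm (fun r ↦ by rw [Real.norm_eq_abs]; exact hb r) h0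
    exact hθ.ne' (tendsto_nhds_unique (havr x) hlim)
  exact exists_neumann_supersolution h hh (by simp) hK hKne

end Literature.Geometry.Riemannian

end
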